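import Mathlib
import HarnessLib
import Literature.Analysis.FluidPDE.Tao2016AveragedNS.TaylorChainCertificate
import Summits.NavierStokesRegularity.NavierStokesRegularity.Theses.ExactWindowRungThree

/-!
# Line `taylor-model` on crux K1b-DR (stmt-NavierStokesRegularity-23954) — readout stub G, helper 0c
# (G0 statement side): flow package, crossing-time selector, chain-enclosure predicate, the K1b-DR blocks,
# and the PACKING theorem

Helper file toward the registered stub `stub_readout : TaylorModelReadout` (S1 → K → K1b-DR; line
`taylor-model`, ideator ns-idea-2 g3). RESHAPE spec (G-PROOFPLAN §5, director KEY-NS #33): G = G0 + G1..G4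
with NAMED shared witnesses; this file is the statement side of G0, texts by the line owner (draft
`pub/ideators/ns-idea-2/l5/G0-draft.lean`, adopted verbatim up to the namespace), over the landed certificate
vocabulary `TaylorChain.CertData` (Literature, p593471):

* `Flow`, `Cross` (shapes of K1b-DR's witnesses `φ j z i k t`, `τ j q`), `stAt` (state vector), `SolvesOn`
  (K1b-DR's ODE clause shape), `InPoly` (entry polytope);
* `IsFlowPackage cd φ` — the conclusions of S1 (`TaylorModelSoundness`) transported to cascade coordinates
  for the certificate's truncated field, per stage: (F0) off-window zero, (F1) existence + majorant value
  bound under the guard, (F2) unconditional uniqueness, (F3) Lipschitz deviation, (F4) segment derivatives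
  with the variational majorant bound, (F5) the Taylor-model bounds relative to the certificate's `TP`, `Vap`
  at its centres (stub G0i proves `Valid → S1 → ∃ φ, IsFlowPackage cd φ`: window coordinates, bilinearity of
  `Qb`, recursion identification of the jets — helpers 0a/0b);
* `tauSel` (crossing-time selector), `Crossing` (G2's internal crossing facts), `ChainEnclosure` (G1's
  conclusion: Lohner-chain soundness — node invariants at levels EI/E/EO, in-step enclosures, κ-restarts);
* `KBlockE1` / `KBlockTube` / `KBlockLip` / `KBlockDyn` / `KBlockLand` — K1b-DR's dynamic and landing blocks
  VERBATIM from `Theses/ExactWindowRungThree.lean` under `data := cd._`, `yb j := cd.x j 0`, `β := cd.β`;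
  `kBlockDyn_of` and the PACKING theorem `k1bDR_of_blocks` (PROVED):
  `cd.Static → cd.StageNumerics → KBlockDyn cd φ τ → KBlockLand cd φ τ → DerivativeEnclosureCertificateR`.

MODEL-lattice bookkeeping only (rung TL-M3 of the NS ladder); nothing here is a statement about the
Navier–Stokes equations, and K1b-DR is NOT proved here (its flow blocks remain hypotheses = stubs G1–G4).
-/

noncomputable section

-- the sub-problem namespace repeats the summit name by design (D-0017)
set_option linter.dupNamespace false

namespace Summit.NavierStokesRegularity.NavierStokesRegularity.Theorems.TaylorModelReadout

open Set Literature.Analysis.FluidPDE.TaoCascade Literature.Analysis.FluidPDE.TaoCascade.TaylorChain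

/-- Shape of K1b-DR's flow witness `φ j z i k t`. [folklore] -/
abbrev Flow := ℕ → (Fin 4 → ℤ → ℝ) → Fin 4 → ℤ → ℝ → ℝ
/-- Shape of K1b-DR's crossing-time witness `τ j q`. [folklore] -/
abbrev Cross := ℕ → (Fin 4 → ℤ → ℝ) → ℝ

/-- The state vector of the flow selector `φ` (stage `j`, start `z`) at time `t`. [folklore] -/
def stAt (φ : Flow) (j : ℕ) (z : (Fin 4 → ℤ → ℝ)) (t : ℝ) : (Fin 4 → ℤ → ℝ) := fun i k => φ j z i k t

/-- `φ j z` solves the window-truncated cascade ODE on `[0, T]` from `z` — literally K1b-DR's ODE clause shape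
(window components; the field is `quadTerm` of the window-truncated state). [folklore] -/
def SolvesOn (cd : CertData) (φ : Flow) (j : ℕ) (z : (Fin 4 → ℤ → ℝ)) (T : ℝ) : Prop :=
  ∀ i k, -cd.Kb ≤ k → k ≤ cd.Ka → φ j z i k 0 = z i k ∧ ∀ t' ∈ Icc 0 T,
    HasDerivWithinAt (φ j z i k)
      (Literature.Analysis.FluidPDE.TaoCascade.quadTerm 1 cd.α
        (fun j' n s' => if -cd.Kb ≤ n ∧ n ≤ cd.Ka then φ j z j' n s' else 0) i k t') (Icc 0 T) t'

/-- Stage-`j` entry polytope membership (K1b-DR's hypothesis on `q`). [folklore] -/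
def InPoly (cd : CertData) (j : ℕ) (q : (Fin 4 → ℤ → ℝ)) : Prop := ∀ l, |cd.ℓ j l q - cd.ctr j l| ≤ cd.rad j l

/-- FLOW PACKAGE = the conclusions of S1 (`TaylorModelSoundness`) transported to cascade coordinates for the
certificate's truncated field, per stage: (F0) off-window components vanish; (F1) existence with the majorant value
bound under the guard `bb·m·T < 1`; (F2) uniqueness against every solution (window components), unconditional —
so `φ` is the maximal-solution selector and the flow property follows; (F3) Lipschitz deviation; (F4) segment
derivatives with the variational majorant bound (K1b-DR's LIP shape, local factor); (F5) the Taylor-model bounds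
relative to the certificate's polynomials `TP`, `Vap` at its centres (valid because `P`, `Wv` ARE the jets —
proved in stub G0i by recursion uniqueness). [folklore] -/
def IsFlowPackage (cd : CertData) (φ : Flow) : Prop :=
  ∀ j, j ≤ cd.N₀ →
    (∀ (z : (Fin 4 → ℤ → ℝ)) i k, ¬(-cd.Kb ≤ k ∧ k ≤ cd.Ka) → ∀ t, φ j z i k t = 0) ∧
    (∀ (z : (Fin 4 → ℤ → ℝ)) (m T : ℝ), 0 ≤ m → cd.InBall j z m → 0 ≤ T → cd.bb j * m * T < 1 →
      SolvesOn cd φ j z T ∧ ∀ t ∈ Icc 0 T, cd.InBall j (stAt φ j z t) (m / (1 - cd.bb j * m * t))) ∧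
    (∀ (z : (Fin 4 → ℤ → ℝ)) (T : ℝ) (ψ : Fin 4 → ℤ → ℝ → ℝ), 0 ≤ T →
      (∀ i k, -cd.Kb ≤ k → k ≤ cd.Ka → ψ i k 0 = z i k ∧ ∀ t' ∈ Icc 0 T,
        HasDerivWithinAt (ψ i k)
          (Literature.Analysis.FluidPDE.TaoCascade.quadTerm 1 cd.α
            (fun j' n s' => if -cd.Kb ≤ n ∧ n ≤ cd.Ka then ψ j' n s' else 0) i k t') (Icc 0 T) t') →
      ∀ i k, -cd.Kb ≤ k → k ≤ cd.Ka → ∀ t' ∈ Icc 0 T, ψ i k t' = φ j z i k t') ∧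
    (∀ (x v : (Fin 4 → ℤ → ℝ)) (m ρ T : ℝ), 0 ≤ m → 0 ≤ ρ → cd.InBall j x m → cd.InBall j v ρ → 0 ≤ T →
      cd.bb j * (m + ρ) * T < 1 → ∀ t ∈ Icc 0 T,
        cd.InBall j (stAt φ j (x + v) t - stAt φ j x t) ((m + ρ) / (1 - cd.bb j * (m + ρ) * t) - m / (1 - cd.bb j * m * t))) ∧
    (∀ (x : (Fin 4 → ℤ → ℝ)) (m ρ T : ℝ), 0 ≤ m → 0 ≤ ρ → cd.InBall j x m → 0 ≤ T → cd.bb j * (m + ρ) * T < 1 →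
      ∀ (z z' : (Fin 4 → ℤ → ℝ)) (dd : ℝ), cd.InBall j (z - x) ρ → cd.InBall j (z' - x) ρ → cd.InBall j (z - z') dd →
      ∀ i k, -cd.Kb ≤ k → k ≤ cd.Ka → ∀ t' ∈ Icc 0 T, ∃ ψ : ℝ → ℝ, ∀ σ ∈ Icc (0:ℝ) 1,
        HasDerivWithinAt (fun σ' : ℝ => φ j (z' + σ' • (z - z')) i k t') (ψ σ) (Icc 0 1) σ ∧
        |ψ σ| ≤ (1 / (1 - cd.bb j * (m + ρ) * t') ^ 2) * dd * cd.ω j k) ∧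
    (∀ s', s' < cd.S j →
      (∀ u ∈ Icc 0 (cd.h j s'), cd.InBall j (stAt φ j (cd.x j s') u - cd.TP j s' u) (cd.Rem (cd.bb j) (cd.mC j s') u)) ∧
      (∀ (v : (Fin 4 → ℤ → ℝ)) (ρ' : ℝ), 0 ≤ ρ' → ρ' ≤ cd.ρO j s' → cd.InBall j v ρ' → cd.Wsupp v →
        ∀ u ∈ Icc 0 (cd.h j s'),
          cd.InBall j (stAt φ j (cd.x j s' + v) u - stAt φ j (cd.x j s') u - cd.Vap j s' u v)
            (CertData.Dev (cd.bb j) (cd.mC j s') ρ' u + cd.RemV (cd.bb j) (cd.mC j s') u * ρ')) ∧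
      (∀ (y y' : (Fin 4 → ℤ → ℝ)) (dd : ℝ), cd.InBall j (y - cd.x j s') (cd.ρO j s') → cd.InBall j (y' - cd.x j s') (cd.ρO j s') →
        cd.InBall j (y - y') dd → cd.Wsupp (y - y') → ∀ u ∈ Icc 0 (cd.h j s'),
          cd.InBall j (stAt φ j y u - stAt φ j y' u - cd.Vap j s' u (y - y'))
            ((cd.RemV (cd.bb j) (cd.mC j s') u +
              (1 / (1 - cd.bb j * (cd.mC j s' + cd.ρO j s') * u) ^ 2 - 1 / (1 - cd.bb j * cd.mC j s' * u) ^ 2)) * dd)))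

/-- The crossing-time selector: first time in the last sub-step at which the section functional reaches its level. [folklore] -/
def tauSel (cd : CertData) (φ : Flow) : Cross := fun j q =>
  sInf {t : ℝ | cd.Tn j (cd.S j - 1) ≤ t ∧ t ≤ cd.Tn j (cd.S j) ∧ cd.lev j ≤ cd.σf j (stAt φ j q t)}

/-- Internal crossing facts (stub G2): `τ j q` lies in the last sub-step, the section is reached exactly there and
not before, and the crossing state sits in the last sub-step's E-level in-step enclosure. [folklore] -/
def Crossing (cd : CertData) (φ : Flow) (τ : Cross) : Prop :=
  ∀ j, j ≤ cd.N₀ → ∀ (q : (Fin 4 → ℤ → ℝ)), InPoly cd j q →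
    cd.Tn j (cd.S j - 1) < τ j q ∧ τ j q ≤ cd.Tn j (cd.S j) ∧ cd.σf j (stAt φ j q (τ j q)) = cd.lev j ∧
    (∀ t, cd.Tn j (cd.S j - 1) ≤ t → t < τ j q → cd.σf j (stAt φ j q t) < cd.lev j) ∧
    cd.InBall j (stAt φ j q (τ j q) - cd.TP j (cd.S j - 1) (τ j q - cd.Tn j (cd.S j - 1))) (cd.Sp j (cd.S j - 1)) ∧
    cd.InBall j (stAt φ j (cd.x j 0) (τ j (cd.x j 0)) - cd.TP j (cd.S j - 1) (τ j (cd.x j 0) - cd.Tn j (cd.S j - 1))) (cd.SpI j (cd.S j - 1))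

/-- CHAIN ENCLOSURE (stub G1's conclusion = the Lohner-chain soundness along the certificate): for every entry state
`q` of stage `j`: (C1) the selector solves on the whole stage horizon; (C2) node invariant at every node,
`φ(q, Tn s) = x s + Cm s ξ + e`, `|ξ| ≤ rP s`, `e ∈ Ball(E s)` (base trajectory from `x j 0`: level `EI`);
(C3) in-step enclosures `TP s u + Ball(Sp s)` (`SpI` for the base trajectory); (C4) κ-RESTARTS: a state `z`
κ-close (window box) to the trajectory at a time `t` of sub-step `s'` is carried with entry deviation `L1 s'·κ`,
then satisfies the node invariant at level `EO` at every later node and the `SpO` in-step enclosures. [folklore] -/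
def ChainEnclosure (cd : CertData) (φ : Flow) : Prop :=
  ∀ j, j ≤ cd.N₀ → ∀ (q : (Fin 4 → ℤ → ℝ)), InPoly cd j q →
    SolvesOn cd φ j q (cd.Tn j (cd.S j)) ∧
    (∀ s', s' ≤ cd.S j → ∃ ξ e : (Fin 4 → ℤ → ℝ),
      (∀ i k, -cd.Kb ≤ k → k ≤ cd.Ka → |ξ i k| ≤ cd.rP j s' i k ∧
        φ j q i k (cd.Tn j s') = cd.x j s' i k + cd.Cm j s' ξ i k + e i k) ∧
      cd.InBall j e (cd.E j s') ∧ (q = cd.x j 0 → cd.InBall j e (cd.EI j s'))) ∧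
    (∀ s', s' < cd.S j → ∀ u ∈ Icc 0 (cd.h j s'),
      cd.InBall j (stAt φ j q (cd.Tn j s' + u) - cd.TP j s' u) (cd.Sp j s') ∧
      (q = cd.x j 0 → cd.InBall j (stAt φ j q (cd.Tn j s' + u) - cd.TP j s' u) (cd.SpI j s'))) ∧
    (∀ s', s' < cd.S j → ∀ t, cd.Tn j s' ≤ t → t ≤ cd.Tn j (s' + 1) →
      ∀ (z : (Fin 4 → ℤ → ℝ)), cd.InBall j (z - stAt φ j q t) (cd.κ j) →
        SolvesOn cd φ j z (cd.Tn j (cd.S j) - t) ∧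
        (∀ u, 0 ≤ u → t + u ≤ cd.Tn j (s' + 1) →
          cd.InBall j (stAt φ j z u - stAt φ j q (t + u)) (cd.L1 j s' * cd.κ j) ∧
          cd.InBall j (stAt φ j z u - cd.TP j s' (t - cd.Tn j s' + u)) (cd.SpO j s')) ∧
        (∀ s'', s' < s'' → s'' ≤ cd.S j → ∃ ξ e : (Fin 4 → ℤ → ℝ),
          (∀ i k, -cd.Kb ≤ k → k ≤ cd.Ka → |ξ i k| ≤ cd.rP j s'' i k ∧
            φ j z i k (cd.Tn j s'' - t) = cd.x j s'' i k + cd.Cm j s'' ξ i k + e i k) ∧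
          cd.InBall j e (cd.EO j s'')) ∧
        (∀ s'', s' < s'' → s'' < cd.S j → ∀ u ∈ Icc 0 (cd.h j s''),
          cd.InBall j (stAt φ j z (cd.Tn j s'' - t + u) - cd.TP j s'' u) (cd.SpO j s'')))


/-- K1b-DR's dynamic block (crossing, E1 read-outs, κ-tube ODE clause, flow-Lipschitz segment derivatives) for the
certificate's data, a flow selector `φ` and a crossing time `τ` — VERBATIM from
`ExactWindowRungThree.DerivativeEnclosureCertificateR` under `data := cd._`. [folklore] -/
def KBlockDyn (cd : CertData) (φ : Flow) (τ : Cross) : Prop :=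
  (∀ j, j ≤ cd.N₀ → ∀ (q : Fin 4 → ℤ → ℝ), (∀ l, |cd.ℓ j l q - cd.ctr j l| ≤ cd.rad j l) → 0 < τ j q ∧ τ j q ≤ cd.τs ∧ cd.as j ≤ |φ j q cd.i₀ 1 (τ j q)| ∧ (∀ i k, -cd.Kb ≤ k → k ≤ cd.Ka → φ j q i k 0 = q i k ∧ ∀ t ∈ Icc 0 (τ j q), |φ j q i k t| ≤ cd.M k - cd.Λ j*cd.δ j*cd.τs*cd.ω j k - cd.mm) ∧ (∀ i, |φ j q i (-cd.Kb) (τ j q)| + cd.Λ j*cd.δ j*cd.τs*cd.ω j (-cd.Kb) ≤ (2:ℝ) ^ (-cd.θ)*(cd.Cb*(2:ℝ) ^ ((3:ℝ)/4*((cd.Kb:ℝ) + 1)))) ∧ (∀ t ∈ Icc 0 (τ j q), ∀ (z : Fin 4 → ℤ → ℝ), (∀ i k, -cd.Kb ≤ k → k ≤ cd.Ka → |z i k - φ j q i k t| ≤ cd.κ j*cd.ω j k) → ∀ i k, -cd.Kb ≤ k → k ≤ cd.Ka → φ j z i k 0 = z i k ∧ ∀ t' ∈ Icc 0 (τ j q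 - t), HasDerivWithinAt (φ j z i k) (Literature.Analysis.FluidPDE.TaoCascade.quadTerm 1 cd.α (fun j' n s' => if -cd.Kb ≤ n ∧ n ≤ cd.Ka then φ j z j' n s' else 0) i k t') (Icc 0 (τ j q - t)) t' ∧ |φ j z i k t'| ≤ cd.M k) ∧ (∀ t ∈ Icc 0 (τ j q), ∀ (z z' : Fin 4 → ℤ → ℝ) (d u : ℝ), (∀ i k, -cd.Kb ≤ k → k ≤ cd.Ka → |z i k - φ j q i k t| ≤ cd.κ j*cd.ω j k ∧ |z' i k - φ j q i k t| ≤ cd.κ j*cd.ω j k ∧ |z i k - z' i k| ≤ d*cd.ω j k) → 0 < u → t + u ≤ τ j q → ∀ i k, -cd.Kb ≤ k → k ≤ cd.Ka → ∀ t' ∈ Icc 0 u, ∃ ψ : ℝ → ℝ, ∀ σ ∈ Icc (0:ℝ) 1, HasDerivWithinAt (fun σ' : ℝ => φ j (z' + σ' • (z - z')) i k t') (ψ σ) (Icc 0 1) σ ∧ |ψ σ| ≤ cd.Λ j*d*cd.ω j k))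

/-- K1b-DR's landing block (base landing with C¹ allowance `β`, segment derivatives of the landing read-out) with
`yb j := cd.x j 0`, `β := cd.β` — VERBATIM under `data := cd._`. [folklore] -/
def KBlockLand (cd : CertData) (φ : Flow) (τ : Cross) : Prop :=
  (∀ j, j ≤ cd.N₀ → (∀ l, |cd.ℓ j l ((cd.x j 0)) - cd.ctr j l| ≤ cd.rad j l) ∧ ∀ v : Fin 4 → ℝ, (∀ i, |v i| ≤ Real.sqrt (10*cd.Cg*(2:ℝ) ^ (-(7:ℝ)*((cd.Ka:ℝ) + 1)))) → ∀ l, |cd.ℓ (cd.nx j) l (fun i k => cd.Lv (cd.nx j)*(if k + 1 ≤ cd.Ka then φ j ((cd.x j 0)) i (1 + k) (τ j ((cd.x j 0))) else v i)/|φ j ((cd.x j 0)) cd.i₀ 1 (τ j ((cd.x j 0)))|) - cd.ctr (cd.nx j) l| + cd.β j l ≤ cd.rad (cd.nx j) l - cd.s (cd.nx j) l ∧ ∀ (q : Fin 4 → ℤ → ℝ), (∀ l', |cd.ℓ j l' q - cd.ctr j l'| ≤ cd.rad j l') → ∃ ψ : ℝ → ℝ, ∀ σ ∈ Icc (0:ℝ)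 1, HasDerivWithinAt (fun σ' : ℝ => cd.ℓ (cd.nx j) l (fun i k => cd.Lv (cd.nx j)*(if k + 1 ≤ cd.Ka then φ j ((cd.x j 0) + σ' • (q - (cd.x j 0))) i (1 + k) (τ j ((cd.x j 0) + σ' • (q - (cd.x j 0)))) else v i)/|φ j ((cd.x j 0) + σ' • (q - (cd.x j 0))) cd.i₀ 1 (τ j ((cd.x j 0) + σ' • (q - (cd.x j 0))))|)) (ψ σ) (Icc 0 1) σ ∧ |ψ σ| ≤ cd.β j l)


/-- K1b-DR's crossing/E1 read-out clauses (stub G2's conclusion). [folklore] -/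
def KBlockE1 (cd : CertData) (φ : Flow) (τ : Cross) : Prop :=
  ∀ j, j ≤ cd.N₀ → ∀ (q : Fin 4 → ℤ → ℝ), (∀ l, |cd.ℓ j l q - cd.ctr j l| ≤ cd.rad j l) → 0 < τ j q ∧ τ j q ≤ cd.τs ∧ cd.as j ≤ |φ j q cd.i₀ 1 (τ j q)| ∧ (∀ i k, -cd.Kb ≤ k → k ≤ cd.Ka → φ j q i k 0 = q i k ∧ ∀ t ∈ Icc 0 (τ j q), |φ j q i k t| ≤ cd.M k - cd.Λ j*cd.δ j*cd.τs*cd.ω j k - cd.mm) ∧ (∀ i, |φ j q i (-cd.Kb) (τ j q)| + cd.Λ j*cd.δ j*cd.τs*cd.ω j (-cd.Kb) ≤ (2:ℝ) ^ (-cd.θ)*(cd.Cb*(2:ℝ) ^ ((3:ℝ)/4*((cd.Kb:ℝ) + 1))))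

/-- K1b-DR's κ-tube ODE clause (stub G3a's conclusion). [folklore] -/
def KBlockTube (cd : CertData) (φ : Flow) (τ : Cross) : Prop :=
  ∀ j, j ≤ cd.N₀ → ∀ (q : Fin 4 → ℤ → ℝ), (∀ l, |cd.ℓ j l q - cd.ctr j l| ≤ cd.rad j l) → (∀ t ∈ Icc 0 (τ j q), ∀ (z : Fin 4 → ℤ → ℝ), (∀ i k, -cd.Kb ≤ k → k ≤ cd.Ka → |z i k - φ j q i k t| ≤ cd.κ j*cd.ω j k) → ∀ i k, -cd.Kb ≤ k → k ≤ cd.Ka → φ j z i k 0 = z i k ∧ ∀ t' ∈ Icc 0 (τ j q - t), HasDerivWithinAt (φ j z i k) (Literature.Analysis.FluidPDE.TaoCascade.quadTerm 1 cd.α (fun j' n s' => if -cd.Kb ≤ n ∧ n ≤ cd.Ka then φ j z j' n s' else 0) i k t') (Icc 0 (τ j q - t)) t' ∧ |φ j z i k t'| ≤ cd.M k)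

/-- K1b-DR's flow-Lipschitz segment-derivative clause (stub G3b's conclusion). [folklore] -/
def KBlockLip (cd : CertData) (φ : Flow) (τ : Cross) : Prop :=
  ∀ j, j ≤ cd.N₀ → ∀ (q : Fin 4 → ℤ → ℝ), (∀ l, |cd.ℓ j l q - cd.ctr j l| ≤ cd.rad j l) → (∀ t ∈ Icc 0 (τ j q), ∀ (z z' : Fin 4 → ℤ → ℝ) (d u : ℝ), (∀ i k, -cd.Kb ≤ k → k ≤ cd.Ka → |z i k - φ j q i k t| ≤ cd.κ j*cd.ω j k ∧ |z' i k - φ j q i k t| ≤ cd.κ j*cd.ω j k ∧ |z i k - z' i k| ≤ d*cd.ω j k) → 0 < u → t + u ≤ τ j q → ∀ i k, -cd.Kb ≤ k → k ≤ cd.Ka → ∀ t' ∈ Icc 0 u, ∃ ψ : ℝ → ℝ, ∀ σ ∈ Icc (0:ℝ) 1, HasDerivWithinAt (fun σ' : ℝ => φ j (z' + σ' • (z - z')) i k t') (ψ σ) (Icc 0 1) σ ∧ |ψ σ| ≤ cd.Λ j*d*cd.ω j k)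

/-- The dynamic block is the conjunction, per stage and entry point, of the E1, tube and Lipschitz blocks.
[folklore] -/
theorem kBlockDyn_of (cd : CertData) (φ : Flow) (τ : Cross) (h1 : KBlockE1 cd φ τ) (h2 : KBlockTube cd φ τ)
    (h3 : KBlockLip cd φ τ) : KBlockDyn cd φ τ := by
  intro j hj q hq
  obtain ⟨a, b, c, e, f⟩ := h1 j hj q hq
  exact ⟨a, b, c, e, f, h2 j hj q hq, h3 j hj q hq⟩

/-- PACKING: the static/numeric clauses of a certificate plus the two dynamic blocks for SOME (φ, τ) give K1b-DR
(this is the composition of the reshaped skeleton: G2–G4 deliver `KBlockDyn`/`KBlockLand` for S1's selector). [folklore] -/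
theorem k1bDR_of_blocks (cd : CertData) (hS : cd.Static) (hN : cd.StageNumerics) (φ : Flow) (τ : Cross)
    (hD : KBlockDyn cd φ τ) (hL : KBlockLand cd φ τ) :
    Summit.NavierStokesRegularity.NavierStokesRegularity.Theses.ExactWindowRungThree.DerivativeEnclosureCertificateR := by
  obtain ⟨h0, h1, h2, h3, h4, h5, h6, h7, h8, h9, h10, h11, h12, h13, h14, h15, h16, h17, h18, h19, h20⟩ := hS
  exact ⟨cd.R, cd.θ, cd.c, cd.η₀, cd.Cb, cd.Cg, cd.τs, cd.mm, cd.Kb, cd.Ka, cd.i₀, cd.α, cd.X₀, cd.M, cd.W, cd.N₀, cd.ℓ,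
    cd.ctr, cd.rad, cd.s, cd.ω, cd.Lv, cd.as, cd.κ, cd.Λ, cd.δ, cd.nx, φ, τ, (fun j => cd.x j 0), cd.β,
    h0, h1, h2, h3, h4, h5, h6, h7, h8, h9, h10, h11, h12, h13, h14, h15, h16, h17, h18, h19, h20, hN.1, hD, hL⟩

end Summit.NavierStokesRegularity.NavierStokesRegularity.Theorems.TaylorModelReadout

end
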